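/-
Copyright (c) 2026 the pub-hodgecm-mathlib formalisation cell (harness21).  Prover seat hodgecm-mathlib-F0P3a-p08 (g19): «S3-ram» seeding wave (LEAD F0P3a-plan (g12), owner
F0P3a-p06 (g15)), row (e2)(b) «[T2-c]-ram» (A-p19 (g26) PLAN-T2c-ram-layer3, inherited 22:13:38Z), LAYER 3 brick (ii-b): the TYPE-B defect `q` on the eigen-field factor; 2026-09-01.
-/
import Literature.NumberTheory.Automorphic.UnramifiedCoordinateModelAntiFixedTypeA   -- ★ p846954 (A-p19): `coord_unique_level₁`, type A; brings ★ p846944 `map_eq_self_iff_of_coord`, `map_add_self_eq_zero_iff_of_coord`, ★ p846518 `coord_unique`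
import Literature.NumberTheory.Automorphic.VandermondeLatticeIndex                   -- ★ `natCard_quotient_span_singleton_of_valuation_eq`
import Mathlib.GroupTheory.Index
import HarnessLib

/-!
# Type B (`θ₁⋆ = −θ₁`): the anti-fixed part of `O₁ = 𝒪_E ⊕ 𝒪_E θ₁` versus `Π·(fixed part)` — DEFECT `q` on the eigen-field factor
# (Serre, *Local Fields* Ch. I §6, Ch. V §3; Hungerford Ch. I Thm. 4.5)

Topic `NumberTheory/Automorphic`; namespace `Literature.NumberTheory.Automorphic`.  THEOREMS ONLY (no definition, no instance, no notation, no named fact, no `sorry`).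
The two-level coordinate model of ★ p846954 (A-p19): the ramified base `OE = j𝒪_F ⊕ j𝒪_F·Π` (involution `σ`, `σ ∘ j = j`, `σΠ = −Π`, ★ p846944) and over it
`O₁ = i(OE) ⊕ i(OE)·θ₁` (`i : OE →+* O₁`, unique coordinates) with an involution `s` over `σ` (`s ∘ i = i ∘ σ`) — here with **`s θ₁ = −θ₁`**, the torus TYPE B of A-p19's
CERT «[T2-c]-ram» (`⋆ = σ ⊗ ι` on `M = L_w(√ε)`; `M ∕ K′` unramified, `K′ = F(Πθ)` ramified).  Cell `pub/hodgecm-mathlib` (D-0151), crux H413 = `stmt-HodgeConjecture-24833`; row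
(e2)(b) LAYER 3, PLAN step (ii-b) (the successor's half: type A, defect `1`, is ★ p846954).
THE MATHEMATICS.  `x = i a + i b θ₁` has `s x = i(σa) − i(σb)θ₁`, so `x` is `⋆`-FIXED iff `σa = a ∧ σb + b = 0` and ANTI-FIXED iff `σa + a = 0 ∧ σb = b` (§1); by ★ p846944
(`OE^σ = j𝒪_F`, `OE⁻ = j𝒪_F·Π`): `O₁^⋆ = i j𝒪_F ⊕ i(j𝒪_F·Π)θ₁`, `O₁⁻ = i(j𝒪_F·Π) ⊕ i j𝒪_F·θ₁`, and with `Π² = j k₀` (`k₀` a uniformiser of `F`)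
`(iΠ)·O₁^⋆ = i(j𝒪_F·Π) ⊕ i j(k₀𝒪_F)·θ₁`.  Along the injective parametrisation `β : 𝒪_F × 𝒪_F → O₁⁻`, `(c, d) ↦ i(jc·Π) + i(jd)θ₁`, the subgroup `(iΠ)·O₁^⋆` is the image of
`𝒪_F × k₀𝒪_F`, hence **`[O₁⁻ : (iΠ)·O₁^⋆] = #(𝒪_F ∕ (k₀)) = #𝓀_F = q`** (§2) — the defect index of ★ p846932 `index_mul_relIndex_map_eq_sq_mul` on the eigen-field factor in type B
(CERT §2: «Type B: `[Λ⁻ : ΠΛ^⋆] = q` ⇒ `[Λ : R] = [Λ^⋆ : R^⋆]²`»).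
HONEST LABEL: HC_CM is proved only modulo the 2 remaining named inputs (hLiu418 24832, h413 24833) until rung 0 closes; unconditional algebra, count-neutral.

* §1 `fixed_anti_iff_typeB`.
* §2 **`relIndex_map_mulLeft_eqLocus_ker_eq_natCard_typeB`** (`[O₁⁻ : (iΠ)O₁^⋆] = Nat.card 𝓀[F]`).

## References
* [SerreLocalFields1979] J.-P. Serre, *Local Fields*, GTM 67 (1979): Ch. I §6 Prop. 15–18 (integral bases), Ch. V §3 (tamely ramified quadratic extensions).
* [Hungerford1974] T. W. Hungerford, *Algebra*, GTM 73 (1974): Ch. I Thm. 4.5 (index of nested subgroups).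
* [Neukirch1999] J. Neukirch, *Algebraic Number Theory* (1999): Ch. I §12.
-/

set_option autoImplicit false

noncomputable section

open scoped ValuativeRel
open ValuativeRel

namespace Literature.NumberTheory.Automorphic

variable {F : Type*} [Field F] [ValuativeRel F] {OE : Type*} [CommRing OE] (j : 𝒪[F] →+* OE) (ϖE : OE)
  (hcoordE : ∀ z : OE, ∃! bc : 𝒪[F] × 𝒪[F], z = j bc.1 + j bc.2 * ϖE)
  (σ : OE →+* OE) (hσj : ∀ b, σ (j b) = j b) (hσϖ : σ ϖE = -ϖE) (h2 : ∀ b : 𝒪[F], b * 2 = 0 → b = 0)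
  {O₁ : Type*} [CommRing O₁] (i : OE →+* O₁) (θ₁ : O₁)
  (hcoord₁ : ∀ z : O₁, ∃! ab : OE × OE, z = i ab.1 + i ab.2 * θ₁)
  (s : O₁ →+* O₁) (hsi : ∀ a, s (i a) = i (σ a)) (hsθ : s θ₁ = -θ₁)

/-! ## §1 Fixed and anti-fixed elements in type B -/

include hcoord₁ hsi hsθ in
/-- **TYPE B: `s x = x ↔ (σa = a ∧ σb + b = 0)` and `s x + x = 0 ↔ (σa + a = 0 ∧ σb = b)`** for `x = i a + i b θ₁` (`s x = i(σa) + i(−σb)θ₁`).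
[cite: SerreLocalFields1979, Ch. I §6 Prop. 15] -/
theorem fixed_anti_iff_typeB (a b : OE) :
    (s (i a + i b * θ₁) = i a + i b * θ₁ ↔ σ a = a ∧ σ b + b = 0) ∧ (s (i a + i b * θ₁) + (i a + i b * θ₁) = 0 ↔ σ a + a = 0 ∧ σ b = b) := by
  have hs : s (i a + i b * θ₁) = i (σ a) + i (-σ b) * θ₁ := by rw [map_add, map_mul, hsi, hsi, hsθ, map_neg]; ring
  refine ⟨?_, ?_⟩
  · rw [hs]
    constructor
    · intro h
      obtain ⟨ha, hb⟩ := coord_unique_level₁ i θ₁ hcoord₁ h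
      exact ⟨ha, by linear_combination -hb⟩
    · rintro ⟨ha, hb⟩
      rw [ha, show -σ b = b by linear_combination -hb]
  · rw [hs]
    constructor
    · intro h
      have h' : i (σ a + a) + i (-σ b + b) * θ₁ = i 0 + i 0 * θ₁ := by
        rw [map_zero, zero_mul, add_zero, map_add, map_add]
        have : i (σ a) + i (-σ b) * θ₁ + (i a + i b * θ₁) = i (σ a) + i a + (i (-σ b) + i b) * θ₁ := by ring
        rw [← this, h]
      obtain ⟨ha, hb⟩ := coord_unique_level₁ i θ₁ hcoord₁ h'
      exact ⟨ha, by linear_combination -hb⟩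
    · rintro ⟨ha, hb⟩
      have : i (σ a) + i (-σ b) * θ₁ + (i a + i b * θ₁) = i (σ a + a) + i (-σ b + b) * θ₁ := by rw [map_add, map_add]; ring
      rw [this, ha, hb, neg_add_cancel, map_zero, zero_mul, add_zero]

/-! ## §2 The defect index `[O₁⁻ : (iΠ)·O₁^⋆] = q` in type B -/

include hcoordE hσj hσϖ h2 hcoord₁ hsi hsθ in
/-- **TYPE B: `[O₁⁻ : (iΠ)·O₁^⋆] = #𝓀_F = q`** — the defect index of ★ p846932 on the eigen-field factor when `s θ₁ = −θ₁` (`Π² = j k₀`, `k₀` of uniformiser valuation in `F`):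
`O₁⁻ = β(𝒪_F × 𝒪_F)`, `(iΠ)·O₁^⋆ = β(𝒪_F × k₀𝒪_F)` for the injective `β(c, d) = i(jc·Π) + i(jd)·θ₁`, so the index is `[𝒪_F : k₀𝒪_F] = #(𝒪_F ∕ (k₀))`.
[cite: SerreLocalFields1979, Ch. I §6 Prop. 17–18, Ch. V §3] [cite: Hungerford1974, Ch. I Thm. 4.5] -/
theorem relIndex_map_mulLeft_eqLocus_ker_eq_natCard_typeB {k₀ : 𝒪[F]} (hϖEsq : ϖE * ϖE = j k₀) (hϖE : ∀ z : OE, ϖE * z = 0 → z = 0)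
    {ϖF : F} (hϖF : IsUniformizingElement ϖF) (hk₀ : valuation F (k₀ : F) = valuation F ϖF) :
    (((RingHom.eqLocus s (RingHom.id O₁)).toAddSubgroup).map (AddMonoidHom.mulLeft (i ϖE))).relIndex (s.toAddMonoidHom + AddMonoidHom.id O₁).ker =
      Nat.card 𝓀[F] := by
  classical
  have hfixE := map_eq_self_iff_of_coord j ϖE hcoordE σ hσj hσϖ h2
  have hantiE := map_add_self_eq_zero_iff_of_coord j ϖE hcoordE σ hσj hσϖ h2
  -- the parametrisation `β` of `O₁⁻`
  set β : 𝒪[F] × 𝒪[F] →+ O₁ := AddMonoidHom.mk' (fun p => i (j p.1 * ϖE) + i (j p.2) * θ₁) (fun p p' => by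
    simp only [Prod.fst_add, Prod.snd_add, map_add, map_mul]; ring) with hβ
  have hβapp : ∀ p : 𝒪[F] × 𝒪[F], β p = i (j p.1 * ϖE) + i (j p.2) * θ₁ := fun _ => rfl
  -- `O₁⁻ = β(⊤)`
  have hAnti : (s.toAddMonoidHom + AddMonoidHom.id O₁).ker = (⊤ : AddSubgroup (𝒪[F] × 𝒪[F])).map β := by
    ext x
    rw [AddMonoidHom.mem_ker, AddSubgroup.mem_map]
    change s x + x = 0 ↔ _
    obtain ⟨⟨a, b⟩, rfl, -⟩ := hcoord₁ x
    rw [(fixed_anti_iff_typeB σ i θ₁ hcoord₁ s hsi hsθ a b).2, hantiE, hfixE]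
    constructor
    · rintro ⟨⟨c, rfl⟩, ⟨d, rfl⟩⟩
      exact ⟨(c, d), AddSubgroup.mem_top _, hβapp (c, d)⟩
    · rintro ⟨⟨c, d⟩, -, h⟩
      obtain ⟨ha, hb⟩ := coord_unique_level₁ i θ₁ hcoord₁ ((hβapp (c, d)).symm.trans h)
      exact ⟨⟨c, ha.symm⟩, ⟨d, hb.symm⟩⟩
  -- `(iΠ)·O₁^⋆ = β(⊤ × k₀𝒪_F)`
  set K : AddSubgroup 𝒪[F] := (⊤ : AddSubgroup 𝒪[F]).map (AddMonoidHom.mulLeft k₀) with hK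
  have hFix : ((RingHom.eqLocus s (RingHom.id O₁)).toAddSubgroup).map (AddMonoidHom.mulLeft (i ϖE)) = ((⊤ : AddSubgroup 𝒪[F]).prod K).map β := by
    ext x
    rw [AddSubgroup.mem_map, AddSubgroup.mem_map]
    constructor
    · rintro ⟨y, hy, rfl⟩
      have hy' : s y = y := hy
      obtain ⟨⟨a, b⟩, rfl, -⟩ := hcoord₁ y
      obtain ⟨ha, hb⟩ := (fixed_anti_iff_typeB σ i θ₁ hcoord₁ s hsi hsθ a b).1.1 hy'
      obtain ⟨c, rfl⟩ := (hfixE a).1 ha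
      obtain ⟨d, rfl⟩ := (hantiE b).1 hb
      refine ⟨(c, k₀ * d), AddSubgroup.mem_prod.2 ⟨AddSubgroup.mem_top _, AddSubgroup.mem_map.2 ⟨d, AddSubgroup.mem_top _, rfl⟩⟩, ?_⟩
      rw [hβapp, AddMonoidHom.coe_mulLeft]
      simp only [map_mul]
      have hsq : i ϖE * i ϖE = i (j k₀) := by rw [← map_mul, hϖEsq]
      linear_combination (-(i (j d) * θ₁)) * hsq
    · rintro ⟨⟨c, d'⟩, hmem, rfl⟩
      obtain ⟨-, hd'⟩ := AddSubgroup.mem_prod.1 hmem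
      obtain ⟨d, -, rfl⟩ := AddSubgroup.mem_map.1 hd'
      refine ⟨i (j c) + i (j d * ϖE) * θ₁, ?_, ?_⟩
      · change s (i (j c) + i (j d * ϖE) * θ₁) = i (j c) + i (j d * ϖE) * θ₁
        refine (fixed_anti_iff_typeB σ i θ₁ hcoord₁ s hsi hsθ (j c) (j d * ϖE)).1.2 ⟨hσj c, ?_⟩
        rw [map_mul, hσj, hσϖ]; ring
      · rw [hβapp, AddMonoidHom.coe_mulLeft, AddMonoidHom.coe_mulLeft]
        simp only [map_mul]
        have hsq : i ϖE * i ϖE = i (j k₀) := by rw [← map_mul, hϖEsq]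
        linear_combination (i (j d) * θ₁) * hsq
  -- `β` is injective
  have hjinj : Function.Injective j := by
    intro b b' hbb
    have h' : j b + j 0 * ϖE = j b' + j 0 * ϖE := by rw [hbb]
    exact (coord_unique j ϖE hcoordE h').1
  have hβinj : Function.Injective β := by
    intro p p' hpp
    rw [hβapp, hβapp] at hpp
    obtain ⟨h1, h2'⟩ := coord_unique_level₁ i θ₁ hcoord₁ hpp
    have h1' : j p.1 = j p'.1 := by
      have : ϖE * (j p.1 - j p'.1) = 0 := by rw [mul_sub, mul_comm, h1, mul_comm, sub_self]
      exact sub_eq_zero.1 (hϖE _ this)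
    exact Prod.ext (hjinj h1') (hjinj h2')
  rw [hFix, hAnti, AddSubgroup.relIndex_map_map_of_injective _ _ hβinj, AddSubgroup.relIndex_top_right, AddSubgroup.index_prod, AddSubgroup.index_top, one_mul]
  -- `[𝒪_F : k₀𝒪_F] = #(𝒪_F ⧸ (k₀)) = #𝓀_F`
  have hKspan : K = (Ideal.span ({k₀} : Set 𝒪[F])).toAddSubgroup := by
    ext a
    rw [hK, AddSubgroup.mem_map, Submodule.mem_toAddSubgroup, Ideal.mem_span_singleton']
    constructor
    · rintro ⟨d, -, rfl⟩
      exact ⟨d, by rw [AddMonoidHom.coe_mulLeft, mul_comm]⟩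
    · rintro ⟨d, rfl⟩
      exact ⟨d, AddSubgroup.mem_top _, by rw [AddMonoidHom.coe_mulLeft, mul_comm]⟩
  have hidx : (Ideal.span ({k₀} : Set 𝒪[F])).toAddSubgroup.index = Nat.card (𝒪[F] ⧸ Ideal.span ({k₀} : Set 𝒪[F])) := rfl
  rw [hKspan, hidx, natCard_quotient_span_singleton_of_valuation_eq hϖF (N := 1) (by rw [pow_one]; exact hk₀), pow_one]

end Literature.NumberTheory.Automorphic

end
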